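import Mathlib

/-!
# Orthonormal product frames (stub `stub_productFrame`)

Line `frame-negativity-singlet-fraction` for the crux `FidelityWitnesses.DiagonalPowerDecay`
(`stmt-MatrixMultiplication-14053`).

In the space of functions `(Fin n × Fin n) → (Fin n × Fin n) → ℂ` with the Hermitian product
`⟨f, g⟩ = Σ_b Σ_c conj (f b c) * g b c`, ANY `r` product vectors `(b, c) ↦ u l b * v l c`
(`l : Fin r`, possibly dependent, possibly zero) span a subspace carrying an orthonormal basis
`e` of `d ≤ r` vectors: each `e s` lies in the span of the products and each product lies in the
span of `e`.

Proof: uncurry into `EuclideanSpace ℂ ((Fin n × Fin n) × (Fin n × Fin n))`, whose inner product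
is exactly the Hermitian product above, let `W` be the span of the products
(`finrank W ≤ r` by `finrank_range_le_card`), take `stdOrthonormalBasis ℂ W`, and curry back.
-/

-- the tree's namespace `Summit.MatrixMultiplication.MatrixMultiplication.…` repeats a component by design
set_option linter.dupNamespace false

namespace Summit.MatrixMultiplication.MatrixMultiplication.Theorems.DiagonalPowerDecay

open scoped BigOperators ComplexConjugate
open InnerProductSpace

/-- **Product frame.** For any `r` products `u l ⊗ v l` in
`(Fin n × Fin n) → (Fin n × Fin n) → ℂ` there is an orthonormal
(for `⟨f, g⟩ = Σ_b Σ_c conj (f b c) * g b c`) frame `e` of `d ≤ r` vectors with every `e s` in the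
span of the `u l ⊗ v l` and every `u l ⊗ v l` in the span of `e`. -/
theorem stub_productFrame {n r : ℕ} (u v : Fin r → (Fin n × Fin n) → ℂ) :
    ∃ (d : ℕ) (e : Fin d → (Fin n × Fin n) → (Fin n × Fin n) → ℂ), d ≤ r ∧
      (∀ s t : Fin d, (∑ b, ∑ c, conj (e s b c) * e t b c) = if s = t then 1 else 0) ∧
      (∀ s, e s ∈ Submodule.span ℂ (Set.range fun l : Fin r => fun b c => u l b * v l c)) ∧
      ∀ l : Fin r, (fun b c => u l b * v l c) ∈ Submodule.span ℂ (Set.range e) := by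
  classical
  -- the products, as vectors of the Euclidean space on `P × P`
  let w : Fin r → EuclideanSpace ℂ ((Fin n × Fin n) × (Fin n × Fin n)) :=
    fun l => WithLp.toLp 2 fun bc => u l bc.1 * v l bc.2
  -- back to curried functions (a linear map)
  let ψ : EuclideanSpace ℂ ((Fin n × Fin n) × (Fin n × Fin n)) →ₗ[ℂ]
      (Fin n × Fin n) → (Fin n × Fin n) → ℂ :=
    { toFun := fun x b c => x (b, c)
      map_add' := fun _ _ => rfl
      map_smul' := fun _ _ => rfl }
  -- the span of the products and an orthonormal basis of it
  let W : Submodule ℂ (EuclideanSpace ℂ ((Fin n × Fin n) × (Fin n × Fin n))) :=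
    Submodule.span ℂ (Set.range w)
  let β : OrthonormalBasis (Fin (Module.finrank ℂ W)) ℂ W := stdOrthonormalBasis ℂ W
  have key : ∀ x y : EuclideanSpace ℂ ((Fin n × Fin n) × (Fin n × Fin n)),
      (∑ b, ∑ c, conj (x (b, c)) * y (b, c)) = inner ℂ x y := by
    intro x y
    simp only [PiLp.inner_apply, RCLike.inner_apply]
    rw [Fintype.sum_prod_type (f := fun bc => y bc * conj (x bc))]
    exact Finset.sum_congr rfl fun b _ => Finset.sum_congr rfl fun c _ => mul_comm _ _
  refine ⟨Module.finrank ℂ W,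
    fun s b c => (β s : EuclideanSpace ℂ ((Fin n × Fin n) × (Fin n × Fin n))) (b, c),
    (finrank_range_le_card (R := ℂ) w).trans_eq (Fintype.card_fin r), ?_, ?_, ?_⟩
  · intro s t
    rw [key, ← Submodule.coe_inner, orthonormal_iff_ite.mp β.orthonormal s t]
  · intro s
    have hs : (β s : EuclideanSpace ℂ ((Fin n × Fin n) × (Fin n × Fin n))) ∈
        Submodule.span ℂ (Set.range w) := (β s).2
    have := Submodule.apply_mem_span_image_of_mem_span ψ hs
    rw [← Set.range_comp] at this
    exact this
  · intro l
    have hlW : w l ∈ W := Submodule.subset_span ⟨l, rfl⟩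
    have h1 : (⟨w l, hlW⟩ : W) ∈ Submodule.span ℂ (Set.range β) := by
      rw [← OrthonormalBasis.coe_toBasis]
      exact β.toBasis.mem_span _
    have h2 := Submodule.apply_mem_span_image_of_mem_span W.subtype h1
    rw [← Set.range_comp] at h2
    have h3 := Submodule.apply_mem_span_image_of_mem_span ψ h2
    rw [← Set.range_comp] at h3
    exact h3

end Summit.MatrixMultiplication.MatrixMultiplication.Theorems.DiagonalPowerDecay
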